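import Summits.BirchSwinnertonDyer.BirchSwinnertonDyer.Theorems.SignedBaseChangeAnticyclotomicEisensteinDivisibilityOfStubsAdmdefV16
import Summits.BirchSwinnertonDyer.BirchSwinnertonDyer.Theorems.SignedBaseChangeAnticyclotomicEisensteinDivisibilityAdmdefUnramRootDichotomy
import HarnessLib

/-! # Line `admdef` v17: the KERNEL CENSUS after the ROOT DICHOTOMY on β AND on γ′ — the crux BY NAME from the FOUR v17 stub texts
# (cite ×16 · S1∣ at `p ∣ h_K` · (Anch±)_NP · (γ′)_NP)

Crux `AnticyclotomicEisensteinDivisibility` (stmt-BirchSwinnertonDyer-20727, route `SignedBaseChange`), line `admdef`, skeleton **v17** (LEAD bsd-line-sbc-p1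
gen 21; registered sha16 876b8352863e4c23, size-trimmed v17.1 with identical statements).  v17 = v16 + the root dichotomy on cell γ′: the γ′ stub (v1–v16 the
raw S1 text on «some `q ∣ N` with `E[p]` unramified») is DERIVED from the cites (2), (9), (10), (11), (16) and the new research text (γ′)_NP = «C⁺⁺
(CHKLL25 Thm 7.1's conclusion shape) on γ′, asked ONLY on the non-primitive locus (NP)» (`…AdmdefUnramRootDichotomy.bdpLowerHalfRatSS_unram_of_facts_of_unramNP`,
p750685).  THIS FILE: **the crux BY NAME from the four v17 stub texts as hypotheses** (`anticyclotomicEisensteinDivisibility_of_admdefStubsV17`, = the v16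
census with its γ′ hypothesis discharged from (γ′)_NP + five cites; `_noBLV` road included).  Honest caveat (Jetchev 2008 Thm 1.4, `c_q ∣` Heegner index):
on the split-multiplicative-unramified part of γ′ (NP) is automatic, so (γ′)_NP is all of γ′ there.  CONDITIONAL (audit `proof.conditional`); BSD / the
crux / (Anch±)_NP / (γ′)_NP are NOT proved by this file (`--supports stmt-BirchSwinnertonDyer-20727`).
[cite: CastellaEtAl2025, Thm. 7.1, Thm. 7.4, (7.2), Thm. 7.5, §7.4 (arXiv:2308.10474v2 pp. 29–33)] [cite: Howard2006, Thm. 3.2.3 (c)]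
[cite: Jetchev2008, Thm. 1.4] [cite: WZhang2014, Thm. 9.1 (proof)]
-/


-- D-0017: single-problem summit, the namespace repeats the problem name by design.
set_option linter.dupNamespace false
set_option autoImplicit false

noncomputable section

open scoped Classical NumberField

open NumberField IsDedekindDomain Field
  Literature.NumberTheory.EllipticCurves Literature.NumberTheory.EllipticCurves.ModularForms
  Literature.NumberTheory.EllipticCurves.Rank1Residual Literature.NumberTheory.EllipticCurves.Castella2018
  Literature.NumberTheory.EllipticCurves.CastellaWan2024 Literature.NumberTheory.GaloisRepresentations
  Literature.NumberTheory.EllipticCurves.YanZhu2026 Literature.NumberTheory.Automorphic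
  Summit.BirchSwinnertonDyer.Rank1Residual.X11b Summit.BirchSwinnertonDyer.Rank1Residual.X11b.Halves
  Summit.BirchSwinnertonDyer.BirchSwinnertonDyer.Theorems
open Literature.NumberTheory.EllipticCurves.AcSigned Literature.NumberTheory.EllipticCurves.CastellaHsuKunduLeeLiu2025
  Literature.NumberTheory.EllipticCurves.BertoliniDarmon2005 Literature.NumberTheory.EllipticCurves.IwasawaDual
open WeierstrassCurve (geomTorsion)

namespace Summit.BirchSwinnertonDyer.BirchSwinnertonDyer.Theorems.SignedBaseChangeAcDivOfStubsAdmdefV17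

open Summit.BirchSwinnertonDyer.BirchSwinnertonDyer.Theses.SignedBaseChange
open Summit.BirchSwinnertonDyer.BirchSwinnertonDyer.Theorems
open SignedBaseChangeAcDivAdmdefRootDichotomy SignedBaseChangeAcDivAdmdefUnramRootDichotomy

/-- **The crux BY NAME from the four v17 stub texts** (cite stub ×16 · S1∣ at `p ∣ h_K` · (Anch±)_NP · (γ′)_NP [v17: γ′ cut by the root dichotomy,
`…AdmdefUnramRootDichotomy.bdpLowerHalfRatSS_unram_of_facts_of_unramNP` with cites (2), (9), (10), (11), (16)]): (a2) from Prop. 2.5; on cell β the v4 texts C⁺⁺_{β′}/C⁺⁺_{β″} by §Glue from [NV]♯, itself from the BRIDGE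
(`…OfStubsAdmdefV15.bridge_text_of_facts`, conjuncts (15)–(16)) and the ROOT DICHOTOMY (`bipartiteNV_text_of_bridge_of_anchorNP`: primitive root ⟹
[NV] by the second law at the root; non-primitive root ⟹ (Anch±)_NP + (Par) (conjuncts (12)–(13)) + W. Zhang's walk + bridge (b)); then the v4 census
verbatim.  CONDITIONAL on the displayed texts. [cite: CastellaEtAl2025, Thm. 7.4, (7.2), Thm. 7.5 and §7.4 (arXiv:2308.10474v2 pp. 30–33)]
[cite: WZhang2014, Thm. 9.1 (proof)] [cite: Howard2006, Thm. 3.2.3 (c)] -/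
theorem anticyclotomicEisensteinDivisibility_of_admdefStubsV17
    (hF : (Literature.NumberTheory.EllipticCurves.YanZhu2026.thm42_XGr₂_isTorsion_charIdeal_le_greenbergAnyRoot ∧
      Literature.NumberTheory.EllipticCurves.YanZhu2026.thm47_ord_localised_iff_greenbergAnyRoot_localised_guarded ∧
      Literature.NumberTheory.EllipticCurves.YanZhu2026.thm33_exists_isHidaRankinLFunction) ∧
    (∀ (W : WeierstrassCurve ℚ) [W.IsGloballyMinimal] (K : Type) [Field K] [NumberField K] (p : ℕ) [Fact p.Prime]
      (κ : Literature.NumberTheory.EllipticCurves.ZpExtension K p) (𝔭 𝔭' : IsDedekindDomain.HeightOneSpectrum (NumberField.RingOfIntegers K)),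
      Literature.NumberTheory.EllipticCurves.AcSigned.longoVigni2019_thm14_signedSelmerDual_rank_one W K p κ 𝔭 𝔭') ∧
    (∀ (N : ℕ) [NeZero N] (W : WeierstrassCurve ℚ) [W.IsGloballyMinimal] (K : Type) [Field K] [NumberField K] (p : ℕ) [Fact p.Prime]
      (κ : Literature.NumberTheory.EllipticCurves.ZpExtension K p) (𝔭 𝔭' : IsDedekindDomain.HeightOneSpectrum (NumberField.RingOfIntegers K)),
      Literature.NumberTheory.EllipticCurves.AcSigned.castellaWan2024_proofThm68_transferInputs N W K p κ 𝔭 𝔭') ∧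
    Literature.NumberTheory.EllipticCurves.BertoliniLongoVenerucci2026.thmA_castellaWan_thm68_exists_isCWBDPLFunction_charIdeal_map_le_rat ∧
    Literature.NumberTheory.IwasawaTheory.Greenberg2016.prop411_selmer_isAlmostDivisible ∧
    Literature.NumberTheory.EllipticCurves.BurungaleCastellaSkinner2025.proofProp422_span_minus_eq_span_bdp_goodReduction ∧
    Literature.NumberTheory.EllipticCurves.BurungaleCastellaSkinner2025.prop422_exists_isBDPLFunction_mu_eq_zero ∧
    Literature.NumberTheory.EllipticCurves.CastellaHsuKunduLeeLiu2025.thm71_cor72_exists_isCWBDPLFunction_charIdeal_map_le_rat ∧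
    (∀ (N : ℕ) [NeZero N] (W : WeierstrassCurve ℚ) [W.IsGloballyMinimal] (K : Type) [Field K] [NumberField K] (p : ℕ) [Fact p.Prime]
      (κ : Literature.NumberTheory.EllipticCurves.ZpExtension K p) (𝔭 𝔭' : IsDedekindDomain.HeightOneSpectrum (NumberField.RingOfIntegers K)),
      Literature.NumberTheory.EllipticCurves.AcSigned.castellaWan2024_lemma67_finrank_torsionCharIdeal N W K p κ 𝔭 𝔭') ∧
    (∀ (N : ℕ) [NeZero N] (W : WeierstrassCurve ℚ) [W.IsGloballyMinimal] (K : Type) [Field K] [NumberField K] (p : ℕ) [Fact p.Prime]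
      (κ : Literature.NumberTheory.EllipticCurves.ZpExtension K p) (𝔭 𝔭' : IsDedekindDomain.HeightOneSpectrum (NumberField.RingOfIntegers K)),
      Literature.NumberTheory.EllipticCurves.AcSigned.castellaWan2024_proofThm68_selmerRel_le_selmerSgn N W K p κ 𝔭 𝔭') ∧
    (∀ (N : ℕ) [NeZero N] (W : WeierstrassCurve ℚ) [W.IsGloballyMinimal] (K : Type) [Field K] [NumberField K] (p : ℕ) [Fact p.Prime]
      (κ : Literature.NumberTheory.EllipticCurves.ZpExtension K p) (𝔭 𝔭' : IsDedekindDomain.HeightOneSpectrum (NumberField.RingOfIntegers K)),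
      Literature.NumberTheory.EllipticCurves.CastellaHsuKunduLeeLiu2025.thm75_howard_rank_one_sq_le_and_le_of_hasUnitLambda N W K p κ 𝔭 𝔭') ∧
    (∀ (K : Type) [Field K] [NumberField K], WeierstrassCurve.exists_casselsTate_pairing (K := K)) ∧
    Literature.NumberTheory.EllipticCurves.dokchitser_selmerCorank_baseChange_mod_two_eq ∧
    Literature.NumberTheory.EllipticCurves.CastellaHsuKunduLeeLiu2025.prop25_XAc_isTorsion ∧
    Literature.NumberTheory.EllipticCurves.DefiniteMultiplicityOne.kimOta2023_thm55_brandtEigenvector_modP_unique ∧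
    Literature.NumberTheory.EllipticCurves.CastellaHsuKunduLeeLiu2025.thm74_eq72_exists_signedSystem_transferClass_dictionary)
    (hDvd : SignedTwoVariableInputs → Literature.NumberTheory.EllipticCurves.ModularForms.nonempty_modularParametrizationData → ∀ (W : WeierstrassCurve ℚ) [W.IsElliptic] [W.IsGloballyMinimal] (p : ℕ) [Fact p.Prime], 5 ≤ p → W.HasGoodReductionAtPrime p → W.frobeniusTrace p = 0 → Literature.NumberTheory.EllipticCurves.Rank1Residual.Surj W p → ∀ (K : Type) [Field K] [NumberField K] (ι : PadicAlgCl p ≃+* ℂ) (v vbar : IsDedekindDomain.HeightOneSpectrum (NumberField.RingOfIntegers K)) (κ₁ κ₂ : Literature.NumberTheory.EllipticCurves.ZpExtension K p) (γ₁ γ₂ : Field.absoluteGaloisGroup K) [Fact (Literature.NumberTheory.EllipticCurves.ZpExtension.IsTopGeneratorPair κ₁ κ₂ γ₁ γ₂)] [NeZero (NumberField.discr K).natAbs] (N : ℕ) [NeZero N] (f : CuspForm (CongruenceSubgroup.Gamma0 N) 2), Literature.NumberTheory.EllipticCurves.ModularForms.IsNewformOf W f → (N : ℤ) = W.conductorNorm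 ℤ → Literature.NumberTheory.EllipticCurves.IsImaginaryQuadratic K → ((Ideal.span {(p : ℤ)}).primesOver (NumberField.RingOfIntegers K)).ncard = 2 → ((p : ℕ) : NumberField.RingOfIntegers K) ∈ v.asIdeal → ((p : ℕ) : NumberField.RingOfIntegers K) ∈ vbar.asIdeal → vbar ≠ v → (∀ (w : NumberField.InfinitePlace K) (k : NumberField.RingOfIntegers K), k ∈ v.asIdeal ↔ ‖ι.symm (w.embedding (k : K))‖ < 1) → IsCoprime (N : ℤ) (NumberField.discr K) → (∀ ℓ : ℕ, ℓ.Prime → ℓ ∣ N → ((Ideal.span {(ℓ : ℤ)}).primesOver (NumberField.RingOfIntegers K)).ncard = 2) → Odd (NumberField.discr K) → NumberField.discr K ≠ -3 → κ₁.IsCyclotomic → κ₂.IsAnticyclotomic → p ∣ NumberField.classNumber K → (haveI : Fact (κ₂.IsTopGenerator γ₂) := ⟨Literature.NumberTheory.EllipticCurves.YanZhu2026.isTopGenerator_of_pair (κ₁ := κ₁) (γ₁ := γ₁)⟩; Module.IsTorsion (Literature.NumberTheory.EllipticCurves.IwasawaAlgebra p) (Literature.NumberTheory.EllipticCurves.Castella2018.AcSelmer.XAc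 (W.baseChange K) p κ₂ vbar ∅ γ₂)) → ∀ (ΩK : ℂ) (Ωp' : (Literature.NumberTheory.EllipticCurves.unrIntegers p)ˣ) (L : Literature.NumberTheory.EllipticCurves.UnrSeries p), ΩK ≠ 0 → Literature.NumberTheory.EllipticCurves.IsBDPLFunction ι v κ₂ γ₂ f ΩK ((Ωp' : Literature.NumberTheory.EllipticCurves.unrIntegers p) : PadicComplex p) L → ∀ J : ℤ_[p] →+* PadicComplexInt p, (∀ x : ℤ_[p], ((J x : PadicComplexInt p) : PadicComplex p) = ((x : ℚ_[p]) : PadicComplex p)) → ∀ (J₀ : Literature.NumberTheory.EllipticCurves.unrIntegers p →+* PadicComplexInt p), (∀ x : Literature.NumberTheory.EllipticCurves.unrIntegers p, ((J₀ x : PadicComplexInt p) : PadicComplex p) = (x : PadicComplex p)) → ∃ k : ℕ, ∀ y ∈ (haveI : Fact (κ₂.IsTopGenerator γ₂) := ⟨Literature.NumberTheory.EllipticCurves.YanZhu2026.isTopGenerator_of_pair (κ₁ := κ₁) (γ₁ := γ₁)⟩; Literature.NumberTheory.EllipticCurves.Castella2018.AcSelmer.XAc.charIdeal (W.baseChange K)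 p κ₂ vbar ∅ γ₂).map (PowerSeries.map J), PowerSeries.C (((p : ℕ) : PadicComplexInt p) ^ k) * y ∈ Ideal.span {PowerSeries.map J₀ L})
    (hAnch :
    ∀ {p : ℕ} [Fact p.Prime] (W : WeierstrassCurve ℚ) [W.IsElliptic] [W.IsGloballyMinimal]
      (K : Type) [Field K] [NumberField K] {N : ℕ} [NeZero N] {f : CuspForm (CongruenceSubgroup.Gamma0 N) 2}
      (_ : IsNewformOf W f),
      (N : ℤ) = W.conductorNorm ℤ → 5 ≤ p → W.HasGoodReductionAtPrime p → W.frobeniusTrace p = 0 →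
      Surj W p →
      IsImaginaryQuadratic K → ((Ideal.span {(p : ℤ)}).primesOver (𝓞 K)).ncard = 2 →
      (∀ ℓ : ℕ, ℓ.Prime → ℓ ∣ N → ((Ideal.span {(ℓ : ℤ)}).primesOver (𝓞 K)).ncard = 2) →
      IsCoprime (N : ℤ) (NumberField.discr K) → ¬ p ∣ NumberField.classNumber K →
      ¬ Squarefree N →
      (∀ q : ℕ, q.Prime → q ∣ N →
        ∃ v : HeightOneSpectrum (𝓞 ℚ), ((q : ℕ) : 𝓞 ℚ) ∈ v.asIdeal ∧
          ∃ 𝔓 ∈ v.primesAbove, ∃ σ ∈ 𝔓.inertia (absoluteGaloisGroup ℚ),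
            ∃ P : W.geomTorsion (p : ℤ), σ • P ≠ P) →
      -- (NP) [v16]: some PINNED `+` tuple whose bottom class is invisible at every admissible Frobenius
      (∃ (ι : PadicAlgCl p ≃+* ℂ) (𝔭 𝔭bar : HeightOneSpectrum (𝓞 K)) (κ : ZpExtension K p) (γ : absoluteGaloisGroup K)
          (hγ : κ.IsTopGenerator γ) (h𝔭 : ((p : ℕ) : 𝓞 K) ∈ 𝔭.asIdeal) (hne : 𝔭bar ≠ 𝔭)
          (h𝔭ns : AcSigned.IsNonsplitIn κ 𝔭) (γ𝔭 : absoluteGaloisGroup (𝔭.adicCompletion K))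
          (hγ𝔭 : κ (resGalOfEmb (closureEmb (K := K) (𝔭.adicCompletion K)) γ𝔭) = κ γ)
          (ΩK : ℂ) (Ωp : (unrIntegers p)ˣ) (L : UnrSeries p)
          (z : AcSigned.selmerLambdaAdic (W.baseChange K) p κ γ (fun _ ↦ .sgn 1))
          (B : CastellaHsuKunduLeeLiu2025.SignedBipartiteSystem W K p κ),
          κ.IsAnticyclotomic ∧ (∀ (w : InfinitePlace K) (k : 𝓞 K), k ∈ 𝔭.asIdeal ↔ ‖ι.symm (w.embedding (k : K))‖ < 1) ∧
          ((p : ℕ) : 𝓞 K) ∈ 𝔭bar.asIdeal ∧ ΩK ≠ 0 ∧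
          IsCWBDPLFunction ι 𝔭 κ γ f (NumberField.discr K) ΩK ((Ωp : unrIntegers p) : ℂ_[p]) L ∧
          AcSigned.TransferInputs (W.baseChange K) p κ γ hγ 𝔭 h𝔭ns γ𝔭 hγ𝔭 𝔭bar (fun h ↦ hne h.symm) h𝔭 1 z L ∧
          CastellaHsuKunduLeeLiu2025.IsSignedBipartiteSystem W K p κ γ N 1 B ∧ B.IsLimitBaseClass z.1 ∧
          ∀ (q : ℕ), IsAdmissiblePrime N K (fun ℓ ↦ W.frobeniusTrace ℓ) p 1 q →
            ∀ (v : HeightOneSpectrum (𝓞 K)), ((q : ℕ) : 𝓞 K) ∈ v.asIdeal →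
            ∀ 𝔓 ∈ v.primesAbove, ∀ (φ : absoluteGaloisGroup K) (hφ : φ ∈ κ.kerSubgroup),
              φ ∈ 𝔓.decompositionSubgroup (absoluteGaloisGroup K) → IsArithFrobAt (𝓞 K) φ 𝔓 →
              resOfLe (geomTorsion (W.baseChange K) ((p : ℤ) ^ 1))
                ((Subgroup.zpowers_le.mpr hφ).trans (κ.kerSubgroup_le_layerSubgroup 0)) (z.1 0 1) = 0) →
      ∀ (c : K ≃ₐ[ℚ] K), c ≠ 1 → ∀ [Module (ZMod p) (AdditiveKoly.Vp W K p)],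
        ∀ n : Finset (AdditiveKoly.AdmQ W K p), Odd n.card →
          (∀ s : Bool, ∃ q ∈ n, ∀ v : HeightOneSpectrum (𝓞 K), ((q : ℕ) : 𝓞 K) ∈ v.asIdeal → ∀ z : AdditiveKoly.Vp W K p,
            (W.baseChange K).torsionLocMap (v.adicCompletion K) ((p ^ 1 : ℕ) : ℤ) (conjAct W c ((p ^ 1 : ℕ) : ℤ) z) =
              AdditiveKoly.sgnP s • (W.baseChange K).torsionLocMap (v.adicCompletion K) ((p ^ 1 : ℕ) : ℤ) z) →
          (∀ μ : Bool, AdditiveKoly.SelQP W K p c n μ = ⊥) →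
          ∃ (S : Brandt.XiSetup N (∏ q ∈ n.image Subtype.val, q)) (ψ : K →ₐ[ℚ] S.D) (I : Submodule ℤ S.D)
            (φ : Brandt.ClassSet S.O → ZMod p),
            Brandt.IsGrossPoint S.O ψ I ∧
            (letI : Fintype (Brandt.ClassSet S.O) := Fintype.ofFinite _
             φ ∈ Brandt.eigenSpace (ZMod p) (N * ∏ q ∈ n.image Subtype.val, q) (Brandt.matrix S.O) (fun ℓ ↦ W.frobeniusTrace ℓ)) ∧
            Brandt.toricPeriod S.O ψ I (fun i ↦ (Brandt.weight S.O i : ZMod p) * φ i) ≠ 0)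
    (hUNP : ∀ {p : ℕ} [Fact p.Prime] (ι : PadicAlgCl p ≃+* ℂ) (W : WeierstrassCurve ℚ) [W.IsElliptic]
      [W.IsGloballyMinimal] (K : Type) [Field K] [NumberField K]
      (𝔭 𝔭bar : HeightOneSpectrum (𝓞 K)) (κ : ZpExtension K p) (γ : absoluteGaloisGroup K)
      [Fact (κ.IsTopGenerator γ)] {N : ℕ} [NeZero N] {f : CuspForm (CongruenceSubgroup.Gamma0 N) 2}
      (_ : IsNewformOf W f),
      (N : ℤ) = W.conductorNorm ℤ → 5 ≤ p → W.HasGoodReductionAtPrime p → W.frobeniusTrace p = 0 →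
      Surj W p →
      IsImaginaryQuadratic K → ((Ideal.span {(p : ℤ)}).primesOver (𝓞 K)).ncard = 2 →
        ((p : ℕ) : 𝓞 K) ∈ 𝔭.asIdeal →
        (∀ (w : InfinitePlace K) (k : 𝓞 K), k ∈ 𝔭.asIdeal ↔ ‖ι.symm (w.embedding (k : K))‖ < 1) →
        ((p : ℕ) : 𝓞 K) ∈ 𝔭bar.asIdeal → 𝔭bar ≠ 𝔭 →
      (∀ ℓ : ℕ, ℓ.Prime → ℓ ∣ N → ((Ideal.span {(ℓ : ℤ)}).primesOver (𝓞 K)).ncard = 2) →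
      IsCoprime (N : ℤ) (NumberField.discr K) → ¬ p ∣ NumberField.classNumber K →
      -- cell γ′: NOT every `q ∣ N` has an inertia element moving a `p`-torsion point (some `q ∣ N` with `E[p]` unramified)
      ¬ (∀ q : ℕ, q.Prime → q ∣ N →
        ∃ v : HeightOneSpectrum (𝓞 ℚ), ((q : ℕ) : 𝓞 ℚ) ∈ v.asIdeal ∧
          ∃ 𝔓 ∈ v.primesAbove, ∃ σ ∈ 𝔓.inertia (absoluteGaloisGroup ℚ),
            ∃ P : W.geomTorsion (p : ℤ), σ • P ≠ P) →
      κ.IsAnticyclotomic →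
      -- (NP): the NON-PRIMITIVE locus — some pinned `+` tuple has bottom class invisible at every admissible Frobenius
      (∃ (ι : PadicAlgCl p ≃+* ℂ) (𝔭 𝔭bar : HeightOneSpectrum (𝓞 K)) (κ : ZpExtension K p) (γ : absoluteGaloisGroup K)
        (hγ : κ.IsTopGenerator γ) (h𝔭 : ((p : ℕ) : 𝓞 K) ∈ 𝔭.asIdeal) (hne : 𝔭bar ≠ 𝔭)
        (h𝔭ns : AcSigned.IsNonsplitIn κ 𝔭) (γ𝔭 : absoluteGaloisGroup (𝔭.adicCompletion K))
        (hγ𝔭 : κ (resGalOfEmb (closureEmb (K := K) (𝔭.adicCompletion K)) γ𝔭) = κ γ)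
        (ΩK : ℂ) (Ωp : (unrIntegers p)ˣ) (L : UnrSeries p)
        (z : AcSigned.selmerLambdaAdic (W.baseChange K) p κ γ (fun _ ↦ .sgn 1))
        (B : CastellaHsuKunduLeeLiu2025.SignedBipartiteSystem W K p κ),
        κ.IsAnticyclotomic ∧ (∀ (w : InfinitePlace K) (k : 𝓞 K), k ∈ 𝔭.asIdeal ↔ ‖ι.symm (w.embedding (k : K))‖ < 1) ∧
        ((p : ℕ) : 𝓞 K) ∈ 𝔭bar.asIdeal ∧ ΩK ≠ 0 ∧
        IsCWBDPLFunction ι 𝔭 κ γ f (NumberField.discr K) ΩK ((Ωp : unrIntegers p) : ℂ_[p]) L ∧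
        AcSigned.TransferInputs (W.baseChange K) p κ γ hγ 𝔭 h𝔭ns γ𝔭 hγ𝔭 𝔭bar (fun h ↦ hne h.symm) h𝔭 1 z L ∧
        CastellaHsuKunduLeeLiu2025.IsSignedBipartiteSystem W K p κ γ N 1 B ∧ B.IsLimitBaseClass z.1 ∧
        ∀ (q : ℕ), IsAdmissiblePrime N K (fun ℓ ↦ W.frobeniusTrace ℓ) p 1 q →
          ∀ (v : HeightOneSpectrum (𝓞 K)), ((q : ℕ) : 𝓞 K) ∈ v.asIdeal →
          ∀ 𝔓 ∈ v.primesAbove, ∀ (φ : absoluteGaloisGroup K) (hφ : φ ∈ κ.kerSubgroup),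
            φ ∈ 𝔓.decompositionSubgroup (absoluteGaloisGroup K) → IsArithFrobAt (𝓞 K) φ 𝔓 →
            resOfLe (geomTorsion (W.baseChange K) ((p : ℤ) ^ 1))
              ((Subgroup.zpowers_le.mpr hφ).trans (κ.kerSubgroup_le_layerSubgroup 0)) (z.1 0 1) = 0) →
      ∃ (ΩK : ℂ) (Ωp : (unrIntegers p)ˣ) (L : UnrSeries p),
        ΩK ≠ 0 ∧
        IsCWBDPLFunction ι 𝔭 κ γ f (NumberField.discr K) ΩK ((Ωp : unrIntegers p) : ℂ_[p]) L ∧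
        ∀ (j : ℤ_[p] →+* unrIntegers p),
          (∀ x : ℤ_[p], ((j x : unrIntegers p) : ℂ_[p]) = algebraMap ℚ_[p] ℂ_[p] (x : ℚ_[p])) →
          ∃ k : ℕ,
            Ideal.span {PowerSeries.C ((p : unrIntegers p) ^ k)} *
                (Castella2018.AcSelmer.XAc.charIdeal (W.baseChange K) p κ 𝔭bar ∅ γ).map (PowerSeries.map j) ≤
              Ideal.span {L}) :
    Summit.BirchSwinnertonDyer.BirchSwinnertonDyer.Theses.SignedBaseChange.AnticyclotomicEisensteinDivisibility := by
  obtain ⟨hYZ, hLV, hTI, hBLV, hGr, hBCS1, hBCS2, hCH71, hCW67, hCWrel, hCH75, hCT, hDD, hP25, hM1, hP01⟩ := hF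
  have hBr := @SignedBaseChangeAcDivOfStubsAdmdefV15.bridge_text_of_facts hP01 hM1
  have hNV := @bipartiteNV_text_of_bridge_of_anchorNP hCT hDD hBr hAnch
  refine SignedBaseChangeAcDivOfStubsAdmdefV4.anticyclotomicEisensteinDivisibility_of_admdefStubsV4 ⟨hYZ, hLV, hTI, hBLV, hGr, hBCS1, hBCS2, hCH71⟩
    (SignedBaseChangeAcDivAdmdefXAcTorsionOfProp25.xAcTorsionSS_classDvd_of_prop25 hP25) hDvd ?_ ?_
    (bdpLowerHalfRatSS_unram_of_facts_of_unramNP hLV hCW67 hCWrel hCH75 hP01 hUNP)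
  · intro p _ ι W _ _ K _ _ 𝔭 𝔭bar κ γ hγF N _ f hf hN hp hgood hap hsurj hK hsplit h𝔭 hι h𝔭bar hne hHeeg hcop hh hnsq _h2m hram hac
    refine SignedBaseChangeAcDivAdmdefBipartiteNVGlue.exists_isCWBDPLFunction_charIdeal_map_le_of_bipartiteNV hLV hCW67 hCWrel
      hCH75 ι W K 𝔭 𝔭bar κ γ hf hN hp hgood hap hsurj hK h𝔭 hι h𝔭bar hne hHeeg hcop hh hac ?_
    intro h𝔭ns γ𝔭 hγ𝔭
    exact hNV ι W K 𝔭 𝔭bar κ γ hf hN hp hgood hap hsurj hK hsplit h𝔭 hι h𝔭bar hne hHeeg hcop hh hnsq hram hac h𝔭ns γ𝔭 hγ𝔭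
  · intro p _ ι W _ _ K _ _ 𝔭 𝔭bar κ γ hγF N _ f hf hN hp hgood hap hsurj hK hsplit h𝔭 hι h𝔭bar hne hHeeg hcop hh hnsq _h2m hram hac
    refine SignedBaseChangeAcDivAdmdefBipartiteNVGlue.exists_isCWBDPLFunction_charIdeal_map_le_of_bipartiteNV hLV hCW67 hCWrel
      hCH75 ι W K 𝔭 𝔭bar κ γ hf hN hp hgood hap hsurj hK h𝔭 hι h𝔭bar hne hHeeg hcop hh hac ?_
    intro h𝔭ns γ𝔭 hγ𝔭
    exact hNV ι W K 𝔭 𝔭bar κ γ hf hN hp hgood hap hsurj hK hsplit h𝔭 hι h𝔭bar hne hHeeg hcop hh hnsq hram hac h𝔭ns γ𝔭 hγ𝔭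

/-- **The same WITHOUT the BLV∘CW conjunct (4)** (road `…_of_noBLV`: the term does not use `hF`'s conjunct (4)). [cite: WZhang2014, Thm. 9.1 (proof)]
[cite: CastellaEtAl2025, Thm. 7.5 and §7.4 (arXiv:2308.10474v2 pp. 31–33)] [cite: Howard2006, Thm. 3.2.3 (c)] -/
theorem anticyclotomicEisensteinDivisibility_of_admdefStubsV17_noBLV
    (hF : (Literature.NumberTheory.EllipticCurves.YanZhu2026.thm42_XGr₂_isTorsion_charIdeal_le_greenbergAnyRoot ∧
      Literature.NumberTheory.EllipticCurves.YanZhu2026.thm47_ord_localised_iff_greenbergAnyRoot_localised_guarded ∧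
      Literature.NumberTheory.EllipticCurves.YanZhu2026.thm33_exists_isHidaRankinLFunction) ∧
    (∀ (W : WeierstrassCurve ℚ) [W.IsGloballyMinimal] (K : Type) [Field K] [NumberField K] (p : ℕ) [Fact p.Prime]
      (κ : Literature.NumberTheory.EllipticCurves.ZpExtension K p) (𝔭 𝔭' : IsDedekindDomain.HeightOneSpectrum (NumberField.RingOfIntegers K)),
      Literature.NumberTheory.EllipticCurves.AcSigned.longoVigni2019_thm14_signedSelmerDual_rank_one W K p κ 𝔭 𝔭') ∧
    (∀ (N : ℕ) [NeZero N] (W : WeierstrassCurve ℚ) [W.IsGloballyMinimal] (K : Type) [Field K] [NumberField K] (p : ℕ) [Fact p.Prime]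
      (κ : Literature.NumberTheory.EllipticCurves.ZpExtension K p) (𝔭 𝔭' : IsDedekindDomain.HeightOneSpectrum (NumberField.RingOfIntegers K)),
      Literature.NumberTheory.EllipticCurves.AcSigned.castellaWan2024_proofThm68_transferInputs N W K p κ 𝔭 𝔭') ∧
    Literature.NumberTheory.EllipticCurves.BertoliniLongoVenerucci2026.thmA_castellaWan_thm68_exists_isCWBDPLFunction_charIdeal_map_le_rat ∧
    Literature.NumberTheory.IwasawaTheory.Greenberg2016.prop411_selmer_isAlmostDivisible ∧
    Literature.NumberTheory.EllipticCurves.BurungaleCastellaSkinner2025.proofProp422_span_minus_eq_span_bdp_goodReduction ∧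
    Literature.NumberTheory.EllipticCurves.BurungaleCastellaSkinner2025.prop422_exists_isBDPLFunction_mu_eq_zero ∧
    Literature.NumberTheory.EllipticCurves.CastellaHsuKunduLeeLiu2025.thm71_cor72_exists_isCWBDPLFunction_charIdeal_map_le_rat ∧
    (∀ (N : ℕ) [NeZero N] (W : WeierstrassCurve ℚ) [W.IsGloballyMinimal] (K : Type) [Field K] [NumberField K] (p : ℕ) [Fact p.Prime]
      (κ : Literature.NumberTheory.EllipticCurves.ZpExtension K p) (𝔭 𝔭' : IsDedekindDomain.HeightOneSpectrum (NumberField.RingOfIntegers K)),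
      Literature.NumberTheory.EllipticCurves.AcSigned.castellaWan2024_lemma67_finrank_torsionCharIdeal N W K p κ 𝔭 𝔭') ∧
    (∀ (N : ℕ) [NeZero N] (W : WeierstrassCurve ℚ) [W.IsGloballyMinimal] (K : Type) [Field K] [NumberField K] (p : ℕ) [Fact p.Prime]
      (κ : Literature.NumberTheory.EllipticCurves.ZpExtension K p) (𝔭 𝔭' : IsDedekindDomain.HeightOneSpectrum (NumberField.RingOfIntegers K)),
      Literature.NumberTheory.EllipticCurves.AcSigned.castellaWan2024_proofThm68_selmerRel_le_selmerSgn N W K p κ 𝔭 𝔭') ∧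
    (∀ (N : ℕ) [NeZero N] (W : WeierstrassCurve ℚ) [W.IsGloballyMinimal] (K : Type) [Field K] [NumberField K] (p : ℕ) [Fact p.Prime]
      (κ : Literature.NumberTheory.EllipticCurves.ZpExtension K p) (𝔭 𝔭' : IsDedekindDomain.HeightOneSpectrum (NumberField.RingOfIntegers K)),
      Literature.NumberTheory.EllipticCurves.CastellaHsuKunduLeeLiu2025.thm75_howard_rank_one_sq_le_and_le_of_hasUnitLambda N W K p κ 𝔭 𝔭') ∧
    (∀ (K : Type) [Field K] [NumberField K], WeierstrassCurve.exists_casselsTate_pairing (K := K)) ∧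
    Literature.NumberTheory.EllipticCurves.dokchitser_selmerCorank_baseChange_mod_two_eq ∧
    Literature.NumberTheory.EllipticCurves.CastellaHsuKunduLeeLiu2025.prop25_XAc_isTorsion ∧
    Literature.NumberTheory.EllipticCurves.DefiniteMultiplicityOne.kimOta2023_thm55_brandtEigenvector_modP_unique ∧
    Literature.NumberTheory.EllipticCurves.CastellaHsuKunduLeeLiu2025.thm74_eq72_exists_signedSystem_transferClass_dictionary)
    (hDvd : SignedTwoVariableInputs → Literature.NumberTheory.EllipticCurves.ModularForms.nonempty_modularParametrizationData → ∀ (W : WeierstrassCurve ℚ) [W.IsElliptic] [W.IsGloballyMinimal] (p : ℕ) [Fact p.Prime], 5 ≤ p → W.HasGoodReductionAtPrime p → W.frobeniusTrace p = 0 → Literature.NumberTheory.EllipticCurves.Rank1Residual.Surj W p → ∀ (K : Type) [Field K] [NumberField K] (ι : PadicAlgCl p ≃+* ℂ) (v vbar : IsDedekindDomain.HeightOneSpectrum (NumberField.RingOfIntegers K)) (κ₁ κ₂ : Literature.NumberTheory.EllipticCurves.ZpExtension K p) (γ₁ γ₂ : Field.absoluteGaloisGroup K) [Fact (Literature.NumberTheory.EllipticCurves.ZpExtension.IsTopGeneratorPair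 κ₁ κ₂ γ₁ γ₂)] [NeZero (NumberField.discr K).natAbs] (N : ℕ) [NeZero N] (f : CuspForm (CongruenceSubgroup.Gamma0 N) 2), Literature.NumberTheory.EllipticCurves.ModularForms.IsNewformOf W f → (N : ℤ) = W.conductorNorm ℤ → Literature.NumberTheory.EllipticCurves.IsImaginaryQuadratic K → ((Ideal.span {(p : ℤ)}).primesOver (NumberField.RingOfIntegers K)).ncard = 2 → ((p : ℕ) : NumberField.RingOfIntegers K) ∈ v.asIdeal → ((p : ℕ) : NumberField.RingOfIntegers K) ∈ vbar.asIdeal → vbar ≠ v → (∀ (w : NumberField.InfinitePlace K) (k : NumberField.RingOfIntegers K), k ∈ v.asIdeal ↔ ‖ι.symm (w.embedding (k : K))‖ < 1) → IsCoprime (N : ℤ) (NumberField.discr K) → (∀ ℓ : ℕ, ℓ.Prime → ℓ ∣ N → ((Ideal.span {(ℓ : ℤ)}).primesOver (NumberField.RingOfIntegers K)).ncard = 2) → Odd (NumberField.discr K) → NumberField.discr K ≠ -3 → κ₁.IsCyclotomic → κ₂.IsAnticyclotomic → p ∣ NumberField.classNumber K → (haveI : Fact (κ₂.IsTopGenerator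 γ₂) := ⟨Literature.NumberTheory.EllipticCurves.YanZhu2026.isTopGenerator_of_pair (κ₁ := κ₁) (γ₁ := γ₁)⟩; Module.IsTorsion (Literature.NumberTheory.EllipticCurves.IwasawaAlgebra p) (Literature.NumberTheory.EllipticCurves.Castella2018.AcSelmer.XAc (W.baseChange K) p κ₂ vbar ∅ γ₂)) → ∀ (ΩK : ℂ) (Ωp' : (Literature.NumberTheory.EllipticCurves.unrIntegers p)ˣ) (L : Literature.NumberTheory.EllipticCurves.UnrSeries p), ΩK ≠ 0 → Literature.NumberTheory.EllipticCurves.IsBDPLFunction ι v κ₂ γ₂ f ΩK ((Ωp' : Literature.NumberTheory.EllipticCurves.unrIntegers p) : PadicComplex p) L → ∀ J : ℤ_[p] →+* PadicComplexInt p, (∀ x : ℤ_[p], ((J x : PadicComplexInt p) : PadicComplex p) = ((x : ℚ_[p]) : PadicComplex p)) → ∀ (J₀ : Literature.NumberTheory.EllipticCurves.unrIntegers p →+* PadicComplexInt p), (∀ x : Literature.NumberTheory.EllipticCurves.unrIntegers p, ((J₀ x : PadicComplexInt p) : PadicComplex p) = (x : PadicComplex p)) → ∃ k : ℕ, ∀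 y ∈ (haveI : Fact (κ₂.IsTopGenerator γ₂) := ⟨Literature.NumberTheory.EllipticCurves.YanZhu2026.isTopGenerator_of_pair (κ₁ := κ₁) (γ₁ := γ₁)⟩; Literature.NumberTheory.EllipticCurves.Castella2018.AcSelmer.XAc.charIdeal (W.baseChange K) p κ₂ vbar ∅ γ₂).map (PowerSeries.map J), PowerSeries.C (((p : ℕ) : PadicComplexInt p) ^ k) * y ∈ Ideal.span {PowerSeries.map J₀ L})
    (hAnch :
    ∀ {p : ℕ} [Fact p.Prime] (W : WeierstrassCurve ℚ) [W.IsElliptic] [W.IsGloballyMinimal]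
      (K : Type) [Field K] [NumberField K] {N : ℕ} [NeZero N] {f : CuspForm (CongruenceSubgroup.Gamma0 N) 2}
      (_ : IsNewformOf W f),
      (N : ℤ) = W.conductorNorm ℤ → 5 ≤ p → W.HasGoodReductionAtPrime p → W.frobeniusTrace p = 0 →
      Surj W p →
      IsImaginaryQuadratic K → ((Ideal.span {(p : ℤ)}).primesOver (𝓞 K)).ncard = 2 →
      (∀ ℓ : ℕ, ℓ.Prime → ℓ ∣ N → ((Ideal.span {(ℓ : ℤ)}).primesOver (𝓞 K)).ncard = 2) →
      IsCoprime (N : ℤ) (NumberField.discr K) → ¬ p ∣ NumberField.classNumber K →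
      ¬ Squarefree N →
      (∀ q : ℕ, q.Prime → q ∣ N →
        ∃ v : HeightOneSpectrum (𝓞 ℚ), ((q : ℕ) : 𝓞 ℚ) ∈ v.asIdeal ∧
          ∃ 𝔓 ∈ v.primesAbove, ∃ σ ∈ 𝔓.inertia (absoluteGaloisGroup ℚ),
            ∃ P : W.geomTorsion (p : ℤ), σ • P ≠ P) →
      -- (NP) [v16]: some PINNED `+` tuple whose bottom class is invisible at every admissible Frobenius
      (∃ (ι : PadicAlgCl p ≃+* ℂ) (𝔭 𝔭bar : HeightOneSpectrum (𝓞 K)) (κ : ZpExtension K p) (γ : absoluteGaloisGroup K)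
          (hγ : κ.IsTopGenerator γ) (h𝔭 : ((p : ℕ) : 𝓞 K) ∈ 𝔭.asIdeal) (hne : 𝔭bar ≠ 𝔭)
          (h𝔭ns : AcSigned.IsNonsplitIn κ 𝔭) (γ𝔭 : absoluteGaloisGroup (𝔭.adicCompletion K))
          (hγ𝔭 : κ (resGalOfEmb (closureEmb (K := K) (𝔭.adicCompletion K)) γ𝔭) = κ γ)
          (ΩK : ℂ) (Ωp : (unrIntegers p)ˣ) (L : UnrSeries p)
          (z : AcSigned.selmerLambdaAdic (W.baseChange K) p κ γ (fun _ ↦ .sgn 1))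
          (B : CastellaHsuKunduLeeLiu2025.SignedBipartiteSystem W K p κ),
          κ.IsAnticyclotomic ∧ (∀ (w : InfinitePlace K) (k : 𝓞 K), k ∈ 𝔭.asIdeal ↔ ‖ι.symm (w.embedding (k : K))‖ < 1) ∧
          ((p : ℕ) : 𝓞 K) ∈ 𝔭bar.asIdeal ∧ ΩK ≠ 0 ∧
          IsCWBDPLFunction ι 𝔭 κ γ f (NumberField.discr K) ΩK ((Ωp : unrIntegers p) : ℂ_[p]) L ∧
          AcSigned.TransferInputs (W.baseChange K) p κ γ hγ 𝔭 h𝔭ns γ𝔭 hγ𝔭 𝔭bar (fun h ↦ hne h.symm) h𝔭 1 z L ∧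
          CastellaHsuKunduLeeLiu2025.IsSignedBipartiteSystem W K p κ γ N 1 B ∧ B.IsLimitBaseClass z.1 ∧
          ∀ (q : ℕ), IsAdmissiblePrime N K (fun ℓ ↦ W.frobeniusTrace ℓ) p 1 q →
            ∀ (v : HeightOneSpectrum (𝓞 K)), ((q : ℕ) : 𝓞 K) ∈ v.asIdeal →
            ∀ 𝔓 ∈ v.primesAbove, ∀ (φ : absoluteGaloisGroup K) (hφ : φ ∈ κ.kerSubgroup),
              φ ∈ 𝔓.decompositionSubgroup (absoluteGaloisGroup K) → IsArithFrobAt (𝓞 K) φ 𝔓 →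
              resOfLe (geomTorsion (W.baseChange K) ((p : ℤ) ^ 1))
                ((Subgroup.zpowers_le.mpr hφ).trans (κ.kerSubgroup_le_layerSubgroup 0)) (z.1 0 1) = 0) →
      ∀ (c : K ≃ₐ[ℚ] K), c ≠ 1 → ∀ [Module (ZMod p) (AdditiveKoly.Vp W K p)],
        ∀ n : Finset (AdditiveKoly.AdmQ W K p), Odd n.card →
          (∀ s : Bool, ∃ q ∈ n, ∀ v : HeightOneSpectrum (𝓞 K), ((q : ℕ) : 𝓞 K) ∈ v.asIdeal → ∀ z : AdditiveKoly.Vp W K p,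
            (W.baseChange K).torsionLocMap (v.adicCompletion K) ((p ^ 1 : ℕ) : ℤ) (conjAct W c ((p ^ 1 : ℕ) : ℤ) z) =
              AdditiveKoly.sgnP s • (W.baseChange K).torsionLocMap (v.adicCompletion K) ((p ^ 1 : ℕ) : ℤ) z) →
          (∀ μ : Bool, AdditiveKoly.SelQP W K p c n μ = ⊥) →
          ∃ (S : Brandt.XiSetup N (∏ q ∈ n.image Subtype.val, q)) (ψ : K →ₐ[ℚ] S.D) (I : Submodule ℤ S.D)
            (φ : Brandt.ClassSet S.O → ZMod p),
            Brandt.IsGrossPoint S.O ψ I ∧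
            (letI : Fintype (Brandt.ClassSet S.O) := Fintype.ofFinite _
             φ ∈ Brandt.eigenSpace (ZMod p) (N * ∏ q ∈ n.image Subtype.val, q) (Brandt.matrix S.O) (fun ℓ ↦ W.frobeniusTrace ℓ)) ∧
            Brandt.toricPeriod S.O ψ I (fun i ↦ (Brandt.weight S.O i : ZMod p) * φ i) ≠ 0)
    (hUNP : ∀ {p : ℕ} [Fact p.Prime] (ι : PadicAlgCl p ≃+* ℂ) (W : WeierstrassCurve ℚ) [W.IsElliptic]
      [W.IsGloballyMinimal] (K : Type) [Field K] [NumberField K]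
      (𝔭 𝔭bar : HeightOneSpectrum (𝓞 K)) (κ : ZpExtension K p) (γ : absoluteGaloisGroup K)
      [Fact (κ.IsTopGenerator γ)] {N : ℕ} [NeZero N] {f : CuspForm (CongruenceSubgroup.Gamma0 N) 2}
      (_ : IsNewformOf W f),
      (N : ℤ) = W.conductorNorm ℤ → 5 ≤ p → W.HasGoodReductionAtPrime p → W.frobeniusTrace p = 0 →
      Surj W p →
      IsImaginaryQuadratic K → ((Ideal.span {(p : ℤ)}).primesOver (𝓞 K)).ncard = 2 →
        ((p : ℕ) : 𝓞 K) ∈ 𝔭.asIdeal →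
        (∀ (w : InfinitePlace K) (k : 𝓞 K), k ∈ 𝔭.asIdeal ↔ ‖ι.symm (w.embedding (k : K))‖ < 1) →
        ((p : ℕ) : 𝓞 K) ∈ 𝔭bar.asIdeal → 𝔭bar ≠ 𝔭 →
      (∀ ℓ : ℕ, ℓ.Prime → ℓ ∣ N → ((Ideal.span {(ℓ : ℤ)}).primesOver (𝓞 K)).ncard = 2) →
      IsCoprime (N : ℤ) (NumberField.discr K) → ¬ p ∣ NumberField.classNumber K →
      -- cell γ′: NOT every `q ∣ N` has an inertia element moving a `p`-torsion point (some `q ∣ N` with `E[p]` unramified)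
      ¬ (∀ q : ℕ, q.Prime → q ∣ N →
        ∃ v : HeightOneSpectrum (𝓞 ℚ), ((q : ℕ) : 𝓞 ℚ) ∈ v.asIdeal ∧
          ∃ 𝔓 ∈ v.primesAbove, ∃ σ ∈ 𝔓.inertia (absoluteGaloisGroup ℚ),
            ∃ P : W.geomTorsion (p : ℤ), σ • P ≠ P) →
      κ.IsAnticyclotomic →
      -- (NP): the NON-PRIMITIVE locus — some pinned `+` tuple has bottom class invisible at every admissible Frobenius
      (∃ (ι : PadicAlgCl p ≃+* ℂ) (𝔭 𝔭bar : HeightOneSpectrum (𝓞 K)) (κ : ZpExtension K p) (γ : absoluteGaloisGroup K)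
        (hγ : κ.IsTopGenerator γ) (h𝔭 : ((p : ℕ) : 𝓞 K) ∈ 𝔭.asIdeal) (hne : 𝔭bar ≠ 𝔭)
        (h𝔭ns : AcSigned.IsNonsplitIn κ 𝔭) (γ𝔭 : absoluteGaloisGroup (𝔭.adicCompletion K))
        (hγ𝔭 : κ (resGalOfEmb (closureEmb (K := K) (𝔭.adicCompletion K)) γ𝔭) = κ γ)
        (ΩK : ℂ) (Ωp : (unrIntegers p)ˣ) (L : UnrSeries p)
        (z : AcSigned.selmerLambdaAdic (W.baseChange K) p κ γ (fun _ ↦ .sgn 1))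
        (B : CastellaHsuKunduLeeLiu2025.SignedBipartiteSystem W K p κ),
        κ.IsAnticyclotomic ∧ (∀ (w : InfinitePlace K) (k : 𝓞 K), k ∈ 𝔭.asIdeal ↔ ‖ι.symm (w.embedding (k : K))‖ < 1) ∧
        ((p : ℕ) : 𝓞 K) ∈ 𝔭bar.asIdeal ∧ ΩK ≠ 0 ∧
        IsCWBDPLFunction ι 𝔭 κ γ f (NumberField.discr K) ΩK ((Ωp : unrIntegers p) : ℂ_[p]) L ∧
        AcSigned.TransferInputs (W.baseChange K) p κ γ hγ 𝔭 h𝔭ns γ𝔭 hγ𝔭 𝔭bar (fun h ↦ hne h.symm) h𝔭 1 z L ∧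
        CastellaHsuKunduLeeLiu2025.IsSignedBipartiteSystem W K p κ γ N 1 B ∧ B.IsLimitBaseClass z.1 ∧
        ∀ (q : ℕ), IsAdmissiblePrime N K (fun ℓ ↦ W.frobeniusTrace ℓ) p 1 q →
          ∀ (v : HeightOneSpectrum (𝓞 K)), ((q : ℕ) : 𝓞 K) ∈ v.asIdeal →
          ∀ 𝔓 ∈ v.primesAbove, ∀ (φ : absoluteGaloisGroup K) (hφ : φ ∈ κ.kerSubgroup),
            φ ∈ 𝔓.decompositionSubgroup (absoluteGaloisGroup K) → IsArithFrobAt (𝓞 K) φ 𝔓 →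
            resOfLe (geomTorsion (W.baseChange K) ((p : ℤ) ^ 1))
              ((Subgroup.zpowers_le.mpr hφ).trans (κ.kerSubgroup_le_layerSubgroup 0)) (z.1 0 1) = 0) →
      ∃ (ΩK : ℂ) (Ωp : (unrIntegers p)ˣ) (L : UnrSeries p),
        ΩK ≠ 0 ∧
        IsCWBDPLFunction ι 𝔭 κ γ f (NumberField.discr K) ΩK ((Ωp : unrIntegers p) : ℂ_[p]) L ∧
        ∀ (j : ℤ_[p] →+* unrIntegers p),
          (∀ x : ℤ_[p], ((j x : unrIntegers p) : ℂ_[p]) = algebraMap ℚ_[p] ℂ_[p] (x : ℚ_[p])) →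
          ∃ k : ℕ,
            Ideal.span {PowerSeries.C ((p : unrIntegers p) ^ k)} *
                (Castella2018.AcSelmer.XAc.charIdeal (W.baseChange K) p κ 𝔭bar ∅ γ).map (PowerSeries.map j) ≤
              Ideal.span {L}) :
    Summit.BirchSwinnertonDyer.BirchSwinnertonDyer.Theses.SignedBaseChange.AnticyclotomicEisensteinDivisibility := by
  obtain ⟨hYZ, hLV, hTI, hBLV, hGr, hBCS1, hBCS2, hCH71, hCW67, hCWrel, hCH75, hCT, hDD, hP25, hM1, hP01⟩ := hF
  have hBr := @SignedBaseChangeAcDivOfStubsAdmdefV15.bridge_text_of_facts hP01 hM1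
  have hNV := @bipartiteNV_text_of_bridge_of_anchorNP hCT hDD hBr hAnch
  refine SignedBaseChangeAcDivOfStubsAdmdefV4.anticyclotomicEisensteinDivisibility_of_admdefStubsV4_noBLV ⟨hYZ, hLV, hTI, hBLV, hGr, hBCS1, hBCS2, hCH71⟩
    (SignedBaseChangeAcDivAdmdefXAcTorsionOfProp25.xAcTorsionSS_classDvd_of_prop25 hP25) hDvd ?_ ?_
    (bdpLowerHalfRatSS_unram_of_facts_of_unramNP hLV hCW67 hCWrel hCH75 hP01 hUNP)
  · intro p _ ι W _ _ K _ _ 𝔭 𝔭bar κ γ hγF N _ f hf hN hp hgood hap hsurj hK hsplit h𝔭 hι h𝔭bar hne hHeeg hcop hh hnsq _h2m hram hac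
    refine SignedBaseChangeAcDivAdmdefBipartiteNVGlue.exists_isCWBDPLFunction_charIdeal_map_le_of_bipartiteNV hLV hCW67 hCWrel
      hCH75 ι W K 𝔭 𝔭bar κ γ hf hN hp hgood hap hsurj hK h𝔭 hι h𝔭bar hne hHeeg hcop hh hac ?_
    intro h𝔭ns γ𝔭 hγ𝔭
    exact hNV ι W K 𝔭 𝔭bar κ γ hf hN hp hgood hap hsurj hK hsplit h𝔭 hι h𝔭bar hne hHeeg hcop hh hnsq hram hac h𝔭ns γ𝔭 hγ𝔭
  · intro p _ ι W _ _ K _ _ 𝔭 𝔭bar κ γ hγF N _ f hf hN hp hgood hap hsurj hK hsplit h𝔭 hι h𝔭bar hne hHeeg hcop hh hnsq _h2m hram hac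
    refine SignedBaseChangeAcDivAdmdefBipartiteNVGlue.exists_isCWBDPLFunction_charIdeal_map_le_of_bipartiteNV hLV hCW67 hCWrel
      hCH75 ι W K 𝔭 𝔭bar κ γ hf hN hp hgood hap hsurj hK h𝔭 hι h𝔭bar hne hHeeg hcop hh hac ?_
    intro h𝔭ns γ𝔭 hγ𝔭
    exact hNV ι W K 𝔭 𝔭bar κ γ hf hN hp hgood hap hsurj hK hsplit h𝔭 hι h𝔭bar hne hHeeg hcop hh hnsq hram hac h𝔭ns γ𝔭 hγ𝔭

end Summit.BirchSwinnertonDyer.BirchSwinnertonDyer.Theorems.SignedBaseChangeAcDivOfStubsAdmdefV17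

end
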